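import Summits.Ventures.QEC.CircuitDistance.PortK2DataBB144X
import Summits.Ventures.QEC.CircuitDistance.K2Chunks
import HarnessLib

/-!
# K2(`[[144,12,12]]`) chunk module — COMPUTATIONAL (native_decide; `Lean.ofReduceBool`)

Cell `qec`, CDX, R146/R152 STEP 1 («computational» header; `ofReduceBool` confined to these chunk modules). Checker of record
`K2.K2Data` (qec-cdx-type-1, PortK2Check); data module of record `PortK2DataBB144X/Z` (p669158/9, crit-1 data audit PASS
2026-08-28T21:20Z); chunk glue `K2Chunks` (idea-1 g2). Cube 1, child 8: leaf group 2 of 3.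
Leaf theorems: the K2 DFS accepts below one descendant state of pivot cube 1 (sector X); sizes are exact DFS visit counts
(eng-1 g2 `k2count.c`), capped so that the gate's native-axiom audit re-verifies every leaf in place. Assemblies re-derive the
child lists in the kernel (`decide`) and end in the literal cube fact `d144X.cube (Ts144X.getD 1 []) (72) (lives144X.getD 1 0) = true`
(the `hcubes` hypothesis of `K2Inst.k2_complete`). Emitted by qec-cdx-eng-1 g2 (`gen2.py`, idea-1's `gen_k2chunks_from_lean.py` lineage).
-/

namespace Summit.Ventures.QEC.CircuitDistance.K2

set_option maxRecDepth 100000 in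
set_option maxHeartbeats 0 in
set_option exponentiation.threshold 1024 in
/-- K2(144) chunk fact `cube144X1_ch8_5` (274662 DFS visits; see the module docstring). -/
theorem cube144X1_ch8_5 : app5 (d144X.dfs (Ts144X.getD 1 []) 6) (150168025975176495104, 1864, 842511188852811565505548557166102187851980945550709635246815444992, 3, 2348542582773833227889480596789337027375681652911766901690793121991471500381448998310236781719575100028616704) = true := by native_decide

set_option maxRecDepth 100000 in
set_option maxHeartbeats 0 in
set_option exponentiation.threshold 1024 in
/-- K2(144) chunk fact `cube144X1_ch8_6` (447105 DFS visits; see the module docstring). -/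
theorem cube144X1_ch8_6 : app5 (d144X.dfs (Ts144X.getD 1 []) 6) (332041393326906219008, 173, 842524044357165637427752892862840917152801123174659897589497856000, 3, 2348542582773833227889480596789337027375681652886055892982649277582800106903990396669881533819050414663794688) = true := by native_decide

set_option maxRecDepth 100000 in
set_option maxHeartbeats 0 in
set_option exponentiation.threshold 1024 in
/-- K2(144) chunk fact `cube144X1_ch8_7` (399394 DFS visits; see the module docstring). -/
theorem cube144X1_ch8_7 : app5 (d144X.dfs (Ts144X.getD 1 []) 6) (2361183241434973702400, 2893, 844143837905778699625499190651920809056143503792392952767481643008, 3, 2348542582773833227889480596789337027375681651240551335661443235427830924346639891687145668185470551315185664) = true := by native_decide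

set_option maxRecDepth 100000 in
set_option maxHeartbeats 0 in
set_option exponentiation.threshold 1024 in
/-- K2(144) chunk fact `cube144X1_ch8_8` (328334 DFS visits; see the module docstring). -/
theorem cube144X1_ch8_8 : app5 (d144X.dfs (Ts144X.getD 1 []) 6) (403114048, 1858, 2527495000045372480750032664408090375653482294335545152973108674560, 3, 2348542582773833227889480596789337027375679966243884638746456068739387985619722789365619259399690482339545088) = true := by native_decide

set_option maxRecDepth 100000 in
set_option maxHeartbeats 0 in
set_option exponentiation.threshold 1024 in
/-- K2(144) chunk fact `cube144X1_ch8_9` (239347 DFS visits; see the module docstring). -/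
theorem cube144X1_ch8_9 : app5 (d144X.dfs (Ts144X.getD 1 []) 6) (9511883888117745664, 2125, 118571099379012626612070037106390000985969933661074488737172492783475948884328448, 3, 2348542582773833227889480596670765927996668182130147950097559651097639521322106851789214693375587437588250624) = true := by native_decide

set_option maxRecDepth 100000 in
set_option maxHeartbeats 0 in
set_option exponentiation.threshold 1024 in
/-- K2(144) chunk fact `cube144X1_ch8_10` (328309 DFS visits; see the module docstring). -/
theorem cube144X1_ch8_10 : app5 (d144X.dfs (Ts144X.getD 1 []) 6) (627189298506259310592, 1885, 242833611528216134707431071701397356913645076350880898707637319144122408554784096256, 3, 2348542582773833227889480353837154399780534317197409597157696320796784639804666695312663476012551786937188352) = true := by native_decide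
end Summit.Ventures.QEC.CircuitDistance.K2
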